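import Summits.CriticalPhenomena.PercolationContinuityZ3.Theorems.PercTorusSliceFillingNoCriticalTorusGiantLocalCountChebyshev
import Summits.CriticalPhenomena.PercolationContinuityZ3.Theorems.PercTorusSliceFillingNoCriticalTorusGiantGiantDensityLeTheta
import HarnessLib

/-!
# Route `PercTorusSliceFilling`, crux `NoCriticalTorusGiant` — torus giants have density at most
# `θ(p)` (support file, item stmt-CriticalPhenomena-5407)

The second-moment sharpening of the necessity result `noCriticalTorusGiant_of_theta_eq_zero`
(`…NoCriticalTorusGiantNecessity.lean`, p150902), unconditional now that both its pieces are in the tree: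

* `giantDensity_le_theta` — for EVERY edge density `p` and every `η > 0`,
  `P_{T_n,p}(∃ x, |C(x)| ≥ (θ(p) + η) n³) → 0` as `n → ∞`: an open cluster of the torus `T_n = (ℤ/nℤ)³`
  of density exceeding `θ_{ℤ³}(p)` is asymptotically impossible.  Composition of the landed side stubs
  F1a `stub_localCountChebyshev` (Chebyshev bound for the number of vertices in `m`-large clusters:
  chart locality of `{|C(x)| ≥ m+1}` below the wrapping scale, independence of the chart events of
  `∞`-distant vertices) and F1b `giantDensity_le_theta_of_localCountChebyshev` (Markov over the giant's
  vertices, `P_{ℤ³,p}(|C(0)| ≥ m+1) ↓ θ(p)`).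
* `real_giant_tendsto_zero_of_theta_lt` — hence at `p_c`: `NoCriticalTorusGiant(ε)` holds for every
  `ε > θ(p_c)`.  So the crux `NoCriticalTorusGiant` follows from `θ(p_c) = 0` (p150902) and its only
  independent content is the exclusion of critical torus giants of density `≤ θ(p_c)` in a
  (counterfactual) discontinuous world `θ(p_c) > 0` — the Easo–Hutchcroft (2024, Rem. 1.4) problem.

No named facts assumed; no definitions.
-/

noncomputable section

namespace Summit.CriticalPhenomena.PercolationContinuityZ3.Theorems.PercTorusSliceFillingNoCriticalTorusGiant

open MeasureTheory Filter Topology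
open Literature.Probability.Percolation Literature.Probability.LatticeModels

/-- **Torus giants have density at most `θ(p)`** (every `p`): for `η > 0`,
`P_{T_n,p}(∃ x, |C(x)| ≥ (θ_{ℤ³}(p) + η) n³) → 0`.  F1b applied to F1a. [folklore] -/
theorem giantDensity_le_theta : ∀ (p : unitInterval) (η : ℝ), 0 < η → Tendsto (fun n : ℕ => (bondPercolation (torusGraph 3 n) p).real {ω | ∃ x : TorusSite 3 n, (theta (zdGraph 3) (0 : Site 3) p + η) * (n : ℝ) ^ 3 ≤ ((openCluster ω x).ncard : ℝ)}) atTop (nhds 0) :=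
  giantDensity_le_theta_of_localCountChebyshev stub_localCountChebyshev

/-- **The crux holds above `θ(p_c)`**: for every `ε > θ(p_c)`,
`P_{T_n,p_c}(∃ x, |C(x)| ≥ ε n³) → 0` (take `η = ε − θ(p_c)` in `giantDensity_le_theta`).  In
particular `θ(p_c) = 0` gives the crux for every `ε > 0` (the route's necessity direction), and a
failure of the crux at density `ε` forces `θ(p_c) ≥ ε`. [folklore] -/
theorem real_giant_tendsto_zero_of_theta_lt {ε : ℝ}
    (hε : theta (zdGraph 3) (0 : Site 3) (criticalProbI 3) < ε) :
    Tendsto (fun n : ℕ => (bondPercolation (torusGraph 3 n) (criticalProbI 3)).real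
        {ω | ∃ x : TorusSite 3 n, ε * (n : ℝ) ^ 3 ≤ ((openCluster ω x).ncard : ℝ)}) atTop (nhds 0) := by
  have h := giantDensity_le_theta (criticalProbI 3) (ε - theta (zdGraph 3) (0 : Site 3) (criticalProbI 3))
    (sub_pos.2 hε)
  simpa only [add_sub_cancel] using h

end Summit.CriticalPhenomena.PercolationContinuityZ3.Theorems.PercTorusSliceFillingNoCriticalTorusGiant

end
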